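import Literature.NumberTheory.Automorphic.AdelicHeightZetaUniform
import HarnessLib

/-!
# The height zeta majorant along injective families of lines, on the affine chart `b ↦ (1 : b)`, and as a comparison test

Topic `NumberTheory/Automorphic`; namespace `Literature.NumberTheory.Automorphic` (sequel of ★ `AdelicHeightZetaConvergence`,
★ `AdelicHeightZetaUniform`).  KERNEL only: proved theorems, no definition, no named fact, no `sorry`.

For a number field `K`, `n = m + 1 ≥ 1`, the Godement–Garrett height `h = vecHeight K` (★ `AdelicVectorHeight`) and `g ∈ GL_n(𝔸_K)`:

* §1 `vecHeight_ratVec_units_smul_vecMul`, `vecHeight_ratVec_rep_mk_vecMul` — `h(ξ g)` depends only on the LINE `K ξ` (product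
  formula ★ `vecHeight_smul_algebraMap`), so the chosen representative `p.rep` of `p = [ξ] ∈ ℙ^{n−1}(K)` may be replaced by `ξ`;
* §2 `summable_vecHeight_rpow_neg_comp_of_injective` — the height zeta majorant `Σ h(ξ_i g)^{−τ}` (`τ > n`) converges along
  ANY family `i ↦ ξ_i` of non-zero vectors spanning pairwise distinct lines (★ `summable_vecHeight_rpow_neg` pulled back);
  `exists_tsum_vecHeight_rpow_neg_comp_le_of_isCompact` — with ONE bound for `g` in a compact set (★
  `exists_tsum_vecHeight_rpow_neg_le_of_isCompact`);
* §3 THE COMPARISON TEST in the form consumed by Eisenstein-series majorants: a family `f : ℙ^{n−1}(K) → E` (resp. `f : ι → E`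
  along an injective family of lines) with `‖f p‖ ≤ C · h(p g)^{−τ}` is summable, `Σ ‖f‖ ≤ C · Σ h^{−τ}`, uniformly for `g` in
  compacta (`summable_of_norm_le_mul_vecHeight_rpow_neg`, `exists_tsum_norm_le_of_norm_le_mul_vecHeight_rpow_neg_of_isCompact`);
* §4 THE AFFINE LINE: `b ↦ [1 : b]` is injective `K → ℙ¹(K)` (`mk_vecCons_one_injective`), hence for `τ > 2`
  `Σ_{b ∈ K} h((1, b) g)^{−τ} < ∞` (`summable_vecHeight_vecCons_one_rpow_neg`), uniformly on compacta, and the same comparison test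
  indexed by `b ∈ K` (`summable_of_norm_le_mul_vecHeight_vecCons_one_rpow_neg`).

This is the counting input of the absolute convergence of the rank-one Siegel–Weil Eisenstein series on `U(W ⊕ W⁻)`, `dim W = 1`, in
Weil's range `N > 2` (`n = 2`, `τ = N`): after the Bruhat decomposition its cosets are `{∞} ⊔ {w n(b) : b ∈ F} ≅ ℙ¹(F)` and the
`b`-term is a Gauss transform bounded by `C · h(1 : b)^{−N}` ([Weil1965, n° 39–41 Thm. 1]; [Garrett2018, §3.3]).  Cell `hodgecm-mathlib`,
FLOOR 0, E-2 desk, crux item H413, child line `Cruxes/H413/Lines/F0_E2SiegelWeilWeilRange.lean`, piece «SW2 (unif)» (U3).  HC_CM is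
proved only modulo the 7 printed citations until rung 0 closes; this file is unconditional and touches no binder.

## References
* [Garrett2018] P. Garrett, *Modern Analysis of Automorphic Forms by Example* (2018), §2.2 Thm. 2.2.2 (PDF pp. 81–82), §3.3.
* [Weil1965] A. Weil, *Sur la formule de Siegel dans la théorie des groupes classiques*, Acta Math. 113 (1965), n° 39 (30), n° 41 Thm. 1.
* [JacquetShalikaAJM1981] H. Jacquet, J. A. Shalika, Amer. J. Math. 103 (1981), §4 (absolute convergence of the Eisenstein majorant).
-/

set_option autoImplicit false

noncomputable section

open scoped NNReal Matrix
open NumberField IsDedekindDomain Matrix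

namespace Literature.NumberTheory.Automorphic

/-! ## §1 The height of `ξ g` depends only on the line `K ξ` -/

section Line

variable (K : Type) [Field K] [NumberField K] {m : ℕ}

/-- `ratVec (c • ξ) = c · ratVec ξ` (the diagonal embedding is `K`-linear). [folklore] -/
private theorem ratVec_units_smul (c : Kˣ) (ξ : Fin (m + 1) → K) :
    ratVec K (c • ξ) = algebraMap K (AdeleRing (𝓞 K) K) (c : K) • ratVec K ξ := by
  ext i
  simp only [ratVec, Pi.smul_apply, Units.smul_def, smul_eq_mul, map_mul]

/-- **`h((c ξ) g) = h(ξ g)` for `c ∈ Kˣ`** (product formula). [cite: Garrett2018, §2.2 Thm. 2.2.2 (PDF p. 81)] -/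
theorem vecHeight_ratVec_units_smul_vecMul (c : Kˣ) {ξ : Fin (m + 1) → K} (hξ : ξ ≠ 0)
    (g : GL (Fin (m + 1)) (AdeleRing (𝓞 K) K)) :
    vecHeight K (ratVec K (c • ξ) ᵥ* (g : Matrix (Fin (m + 1)) (Fin (m + 1)) (AdeleRing (𝓞 K) K))) =
      vecHeight K (ratVec K ξ ᵥ* (g : Matrix (Fin (m + 1)) (Fin (m + 1)) (AdeleRing (𝓞 K) K))) := by
  classical
  rw [ratVec_units_smul, Matrix.smul_vecMul]
  exact vecHeight_smul_algebraMap (isHeightFinite_principalVec_vecMul hξ g) c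

/-- **`h(p.rep g) = h(ξ g)` for `p = [ξ]`**: the height along the chosen representative of a point of `ℙ^{n−1}(K)` is the height
along any representative. [cite: Garrett2018, §2.2 Thm. 2.2.2 (PDF p. 81)] -/
theorem vecHeight_ratVec_rep_mk_vecMul {ξ : Fin (m + 1) → K} (hξ : ξ ≠ 0)
    (g : GL (Fin (m + 1)) (AdeleRing (𝓞 K) K)) :
    vecHeight K (ratVec K (Projectivization.mk K ξ hξ).rep ᵥ* (g : Matrix (Fin (m + 1)) (Fin (m + 1)) (AdeleRing (𝓞 K) K))) =
      vecHeight K (ratVec K ξ ᵥ* (g : Matrix (Fin (m + 1)) (Fin (m + 1)) (AdeleRing (𝓞 K) K))) := by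
  obtain ⟨c, hc⟩ := Projectivization.exists_smul_eq_mk_rep K ξ hξ
  rw [← hc]
  exact vecHeight_ratVec_units_smul_vecMul K c hξ g

end Line

/-! ## §2 The height zeta majorant along an injective family of lines -/

section Family

variable (K : Type) [Field K] [NumberField K] {m : ℕ} {ι : Type*}

/-- **Convergence along an injective family of lines**: if `ξ : ι → Kⁿ ∖ 0` spans pairwise distinct lines, then
`Σ_i h(ξ_i g)^{−τ} < ∞` for `τ > n`. [cite: Garrett2018, §3.3; JacquetShalikaAJM1981, §4] -/
theorem summable_vecHeight_rpow_neg_comp_of_injective (g : GL (Fin (m + 1)) (AdeleRing (𝓞 K) K)) {τ : ℝ}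
    (hτ : (m + 1 : ℝ) < τ) (ξ : ι → Fin (m + 1) → K) (hξ : ∀ i, ξ i ≠ 0)
    (hinj : Function.Injective fun i => Projectivization.mk K (ξ i) (hξ i)) :
    Summable fun i : ι =>
      ((vecHeight K (ratVec K (ξ i) ᵥ* (g : Matrix (Fin (m + 1)) (Fin (m + 1)) (AdeleRing (𝓞 K) K))) : ℝ≥0) : ℝ) ^ (-τ) := by
  have h := (summable_vecHeight_rpow_neg K g hτ).comp_injective hinj
  refine h.congr fun i => ?_
  simp only [Function.comp_apply, vecHeight_ratVec_rep_mk_vecMul K (hξ i) g]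

/-- The partial sum along an injective family of lines is at most the full height zeta sum (non-negative terms).
[cite: Garrett2018, §3.3; JacquetShalikaAJM1981, §4] -/
theorem tsum_vecHeight_rpow_neg_comp_le (g : GL (Fin (m + 1)) (AdeleRing (𝓞 K) K)) {τ : ℝ}
    (hτ : (m + 1 : ℝ) < τ) (ξ : ι → Fin (m + 1) → K) (hξ : ∀ i, ξ i ≠ 0)
    (hinj : Function.Injective fun i => Projectivization.mk K (ξ i) (hξ i)) :
    ∑' i : ι, ((vecHeight K (ratVec K (ξ i) ᵥ* (g : Matrix (Fin (m + 1)) (Fin (m + 1)) (AdeleRing (𝓞 K) K))) : ℝ≥0) : ℝ) ^ (-τ) ≤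
      ∑' p : Projectivization K (Fin (m + 1) → K),
        ((vecHeight K (ratVec K p.rep ᵥ* (g : Matrix (Fin (m + 1)) (Fin (m + 1)) (AdeleRing (𝓞 K) K))) : ℝ≥0) : ℝ) ^ (-τ) := by
  have h := tsum_comp_le_tsum_of_inj (summable_vecHeight_rpow_neg K g hτ)
    (fun p => Real.rpow_nonneg (NNReal.coe_nonneg _) _) hinj
  refine le_of_eq_of_le (tsum_congr fun i => ?_) h
  simp only [Function.comp_apply, vecHeight_ratVec_rep_mk_vecMul K (hξ i) g]

/-- **One bound on compacta**: for compact `C ⊆ GL_n(𝔸_K)` and `τ > n` there is `B` with `Σ_i h(ξ_i g)^{−τ} ≤ B` for every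
`g ∈ C` and every injective family of lines `ξ`. [cite: Garrett2018, Thm. 2.2.2 (PDF p. 82) and §3.3] -/
theorem exists_tsum_vecHeight_rpow_neg_comp_le_of_isCompact {C : Set (GL (Fin (m + 1)) (AdeleRing (𝓞 K) K))}
    (hC : IsCompact C) {τ : ℝ} (hτ : (m + 1 : ℝ) < τ) :
    ∃ B : ℝ, ∀ g ∈ C, ∀ (ξ : ι → Fin (m + 1) → K) (hξ : ∀ i, ξ i ≠ 0),
      (Function.Injective fun i => Projectivization.mk K (ξ i) (hξ i)) →
        ∑' i : ι, ((vecHeight K (ratVec K (ξ i) ᵥ* (g : Matrix (Fin (m + 1)) (Fin (m + 1)) (AdeleRing (𝓞 K) K))) : ℝ≥0) :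
          ℝ) ^ (-τ) ≤ B := by
  obtain ⟨B, hB⟩ := exists_tsum_vecHeight_rpow_neg_le_of_isCompact K hC hτ
  exact ⟨B, fun g hg ξ hξ hinj => (tsum_vecHeight_rpow_neg_comp_le K g hτ ξ hξ hinj).trans (hB g hg)⟩

end Family

/-! ## §3 The comparison test against the height zeta majorant -/

section Comparison

variable (K : Type) [Field K] [NumberField K] {m : ℕ} {ι : Type*}
variable {E : Type*} [NormedAddCommGroup E] [CompleteSpace E]

/-- **Comparison test, projective form**: a family on `ℙ^{n−1}(K)` dominated by `C · h(p g)^{−τ}`, `τ > n`, is summable.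
[cite: Garrett2018, §3.3; JacquetShalikaAJM1981, §4] -/
theorem summable_of_norm_le_mul_vecHeight_rpow_neg (g : GL (Fin (m + 1)) (AdeleRing (𝓞 K) K)) {τ : ℝ}
    (hτ : (m + 1 : ℝ) < τ) (C : ℝ) (f : Projectivization K (Fin (m + 1) → K) → E)
    (hf : ∀ p, ‖f p‖ ≤ C * ((vecHeight K (ratVec K p.rep ᵥ* (g : Matrix (Fin (m + 1)) (Fin (m + 1)) (AdeleRing (𝓞 K) K))) :
      ℝ≥0) : ℝ) ^ (-τ)) :
    Summable f :=
  Summable.of_norm_bounded ((summable_vecHeight_rpow_neg K g hτ).mul_left C) hf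

/-- **Comparison test along an injective family of lines** (e.g. a Bruhat cell): `‖f i‖ ≤ C · h(ξ_i g)^{−τ}`, `τ > n` ⇒ `f` summable
and `Σ ‖f i‖ ≤ C · Σ_i h(ξ_i g)^{−τ}`. [cite: Garrett2018, §3.3; Weil1965, n° 41 Thm. 1] -/
theorem summable_of_norm_le_mul_vecHeight_rpow_neg_comp (g : GL (Fin (m + 1)) (AdeleRing (𝓞 K) K)) {τ : ℝ}
    (hτ : (m + 1 : ℝ) < τ) (ξ : ι → Fin (m + 1) → K) (hξ : ∀ i, ξ i ≠ 0)
    (hinj : Function.Injective fun i => Projectivization.mk K (ξ i) (hξ i)) (C : ℝ) (f : ι → E)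
    (hf : ∀ i, ‖f i‖ ≤ C * ((vecHeight K (ratVec K (ξ i) ᵥ* (g : Matrix (Fin (m + 1)) (Fin (m + 1)) (AdeleRing (𝓞 K) K))) :
      ℝ≥0) : ℝ) ^ (-τ)) :
    Summable f ∧ ∑' i, ‖f i‖ ≤
      C * ∑' i : ι, ((vecHeight K (ratVec K (ξ i) ᵥ* (g : Matrix (Fin (m + 1)) (Fin (m + 1)) (AdeleRing (𝓞 K) K))) : ℝ≥0) :
        ℝ) ^ (-τ) := by
  have hs := (summable_vecHeight_rpow_neg_comp_of_injective K g hτ ξ hξ hinj).mul_left C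
  have hsum : Summable f := Summable.of_norm_bounded hs hf
  refine ⟨hsum, ?_⟩
  rw [← tsum_mul_left]
  exact Summable.tsum_le_tsum hf (Summable.of_nonneg_of_le (fun i => norm_nonneg _) hf hs) hs

/-- **Uniformly on compacta**: for compact `C₀ ⊆ GL_n(𝔸_K)`, `τ > n` and a constant `C`, there is ONE `B` such that every family
`f` dominated by `C · h(ξ_i g)^{−τ}` along an injective family of lines, for some `g ∈ C₀`, is summable with `Σ ‖f i‖ ≤ B`.
(The shape of the E-2 line's `stub_SW2_siegelWeil` (ii): one bound for all `(x₁, x₂)` in a compact set.)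
[cite: Garrett2018, Thm. 2.2.2 (PDF p. 82) and §3.3; Weil1965, n° 41 Thm. 1] -/
theorem exists_tsum_norm_le_of_norm_le_mul_vecHeight_rpow_neg_of_isCompact
    {C₀ : Set (GL (Fin (m + 1)) (AdeleRing (𝓞 K) K))} (hC₀ : IsCompact C₀) {τ : ℝ} (hτ : (m + 1 : ℝ) < τ) (C : ℝ)
    (hC : 0 ≤ C) :
    ∃ B : ℝ, ∀ g ∈ C₀, ∀ (ξ : ι → Fin (m + 1) → K) (hξ : ∀ i, ξ i ≠ 0),
      (Function.Injective fun i => Projectivization.mk K (ξ i) (hξ i)) → ∀ f : ι → E,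
        (∀ i, ‖f i‖ ≤ C * ((vecHeight K (ratVec K (ξ i) ᵥ* (g : Matrix (Fin (m + 1)) (Fin (m + 1)) (AdeleRing (𝓞 K) K))) :
          ℝ≥0) : ℝ) ^ (-τ)) →
          Summable f ∧ ∑' i, ‖f i‖ ≤ B := by
  obtain ⟨B, hB⟩ := exists_tsum_vecHeight_rpow_neg_comp_le_of_isCompact K (ι := ι) hC₀ hτ
  refine ⟨C * B, fun g hg ξ hξ hinj f hf => ?_⟩
  obtain ⟨hsum, hle⟩ := summable_of_norm_le_mul_vecHeight_rpow_neg_comp K g hτ ξ hξ hinj C f hf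
  exact ⟨hsum, hle.trans (mul_le_mul_of_nonneg_left (hB g hg ξ hξ hinj) hC)⟩

end Comparison

/-! ## §4 The affine line `b ↦ (1 : b)` -/

section AffineLine

variable (K : Type) [Field K] [NumberField K]

/-- `(1, b) ≠ 0`. [folklore] -/
private theorem vecCons_one_ne_zero (b : K) : (![1, b] : Fin (1 + 1) → K) ≠ 0 := by
  intro h
  have := congrFun h 0
  simp at this

/-- **`b ↦ [1 : b]` is injective** `K → ℙ¹(K)` (the affine chart `x₀ ≠ 0` of the projective line). [folklore] -/
private theorem mk_vecCons_one_injective :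
    Function.Injective fun b : K => Projectivization.mk K (![1, b] : Fin (1 + 1) → K) (vecCons_one_ne_zero K b) := by
  intro b b' h
  obtain ⟨a, ha⟩ := (Projectivization.mk_eq_mk_iff K _ _ (vecCons_one_ne_zero K b) (vecCons_one_ne_zero K b')).1 h
  have h0 := congrFun ha 0
  have h1 := congrFun ha 1
  simp only [Pi.smul_apply, Matrix.cons_val_zero, Matrix.cons_val_one, Units.smul_def, smul_eq_mul,
    mul_one] at h0 h1
  rw [h0, one_mul] at h1
  exact h1.symm

variable {E : Type*} [NormedAddCommGroup E] [CompleteSpace E]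

/-- **`Σ_{b ∈ K} h((1, b) g)^{−τ} < ∞` for `τ > 2`** (the affine chart of the height zeta function of `ℙ¹(K)`).
[cite: Garrett2018, §3.3; JacquetShalikaAJM1981, §4] -/
theorem summable_vecHeight_vecCons_one_rpow_neg (g : GL (Fin (1 + 1)) (AdeleRing (𝓞 K) K)) {τ : ℝ} (hτ : 2 < τ) :
    Summable fun b : K =>
      ((vecHeight K (ratVec K (![1, b] : Fin (1 + 1) → K) ᵥ* (g : Matrix (Fin (1 + 1)) (Fin (1 + 1)) (AdeleRing (𝓞 K) K))) :
        ℝ≥0) : ℝ) ^ (-τ) :=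
  summable_vecHeight_rpow_neg_comp_of_injective K g (by norm_num; exact hτ) (fun b : K => (![1, b] : Fin (1 + 1) → K))
    (vecCons_one_ne_zero K) (mk_vecCons_one_injective K)

/-- **Comparison test on the affine line**: `‖f b‖ ≤ C · h((1, b) g)^{−τ}` for all `b ∈ K`, `τ > 2` ⇒ `f` summable and
`Σ_b ‖f b‖ ≤ C · Σ_b h((1, b) g)^{−τ}`. [cite: Weil1965, n° 41 Thm. 1; Garrett2018, §3.3] -/
theorem summable_of_norm_le_mul_vecHeight_vecCons_one_rpow_neg (g : GL (Fin (1 + 1)) (AdeleRing (𝓞 K) K)) {τ : ℝ}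
    (hτ : 2 < τ) (C : ℝ) (f : K → E)
    (hf : ∀ b, ‖f b‖ ≤ C * ((vecHeight K (ratVec K (![1, b] : Fin (1 + 1) → K) ᵥ*
      (g : Matrix (Fin (1 + 1)) (Fin (1 + 1)) (AdeleRing (𝓞 K) K))) : ℝ≥0) : ℝ) ^ (-τ)) :
    Summable f ∧ ∑' b, ‖f b‖ ≤ C * ∑' b : K, ((vecHeight K (ratVec K (![1, b] : Fin (1 + 1) → K) ᵥ*
      (g : Matrix (Fin (1 + 1)) (Fin (1 + 1)) (AdeleRing (𝓞 K) K))) : ℝ≥0) : ℝ) ^ (-τ) :=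
  summable_of_norm_le_mul_vecHeight_rpow_neg_comp K g (by norm_num; exact hτ) (fun b : K => (![1, b] : Fin (1 + 1) → K))
    (vecCons_one_ne_zero K) (mk_vecCons_one_injective K) C f hf

/-- **Uniformly on compacta, affine form**: for compact `C₀ ⊆ GL₂(𝔸_K)`, `τ > 2`, `C ≥ 0` there is ONE `B` with: every `f : K → E`
dominated by `C · h((1, b) g)^{−τ}` for some `g ∈ C₀` is summable with `Σ_b ‖f b‖ ≤ B`. [cite: Weil1965, n° 41 Thm. 1; Garrett2018, Thm. 2.2.2] -/
theorem exists_tsum_norm_le_of_norm_le_mul_vecHeight_vecCons_one_rpow_neg_of_isCompact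
    {C₀ : Set (GL (Fin (1 + 1)) (AdeleRing (𝓞 K) K))} (hC₀ : IsCompact C₀) {τ : ℝ} (hτ : 2 < τ) (C : ℝ) (hC : 0 ≤ C) :
    ∃ B : ℝ, ∀ g ∈ C₀, ∀ f : K → E,
      (∀ b, ‖f b‖ ≤ C * ((vecHeight K (ratVec K (![1, b] : Fin (1 + 1) → K) ᵥ*
        (g : Matrix (Fin (1 + 1)) (Fin (1 + 1)) (AdeleRing (𝓞 K) K))) : ℝ≥0) : ℝ) ^ (-τ)) →
        Summable f ∧ ∑' b, ‖f b‖ ≤ B := by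
  obtain ⟨B, hB⟩ := exists_tsum_norm_le_of_norm_le_mul_vecHeight_rpow_neg_of_isCompact K (ι := K) (E := E) hC₀
    (by norm_num; exact hτ) C hC
  exact ⟨B, fun g hg f hf => hB g hg (fun b : K => (![1, b] : Fin (1 + 1) → K)) (vecCons_one_ne_zero K)
    (mk_vecCons_one_injective K) f hf⟩

end AffineLine

end Literature.NumberTheory.Automorphic

end
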